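import Summits.CriticalPhenomena.PercolationContinuityZ3.Theorems.PercNearOneGluingNoHeavyQuantGatedSliceMixLawKinkU1
import Summits.CriticalPhenomena.PercolationContinuityZ3.Theorems.PercNearOneGluingNoHeavyQuantGatedSliceMixLawPCells
import HarnessLib

/-!
# QUANT lane R8, T-DEC, leg (III), blob case — cell P-DEAR of regime B: the kink member (I_{U₁}) when the mid has TOP ROOM at the
# raised floor (`ρ₁·k₂ ≤ S`), and `MixLawCellPDear` MODULO (I_{U₁}) ON THE THIN REGIME ONLY

builds on p205010 (kernel theorem, internal audit signed; external expert review pending)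

Support file (`--supports stmt-CriticalPhenomena-4575`), QUANT lane seat prim-quant-arm-2 (gen 36), rung R8 of
`run/shared/lean/prim/quant/LADDER.md`.  Theorems only, standard axioms, no sorries, no definitions.  Assembles `…KinkU1`
(`kink_member_U1`, `usage_twin_gap`) and `…PCells` (`decAtT_movedTwoPoint_PDear_of_kink`); tool: census-2 g61's `pooled_dear` at a RAISED
floor (it needs only `y·k₂ ≤ S`, no threshold — lane INBOX l.1072/l.1088).

* `LawDec.usage_mono_floor` — the usage rate of a compatible mid pair is nondecreasing in the floor `x` (`pairGate x = max(ρ, x² + (1−x)ρ)`).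
* `LawDec.kink_member_U1_of_topRoom` — (I_{U₁}) whenever `ρ₁·k₂ ≤ S` (`ρ₁ = (t−2k₁)/(k₂−k₁)`, i.e. `U₁ ≤ X_S = S/(k₂−S)`): `pooled_dear`
  at the floor `ρ₁` (there `u = U₁` and `k₁` is exactly dear) plus `usage_mono_floor`.
* `LawDec.kink_member_U1'` — (I_{U₁}) from the frame given its validity on the THIN REGIME
  `{u z < m₂' < u(z+m₁)} ∩ {(t−2k₁)/u < k₂+a−t} ∩ {S(k₂−k₁) < (t−2k₁)k₂}` only.
* **`LawDec.mixLawCellPDear_of_thinKink`** — `MixLawCellPDear` follows from (I_{U₁}) on the thin regime (stated as a hypothesis,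
  quantified over the cell).  Seat census of the thin regime: 1 500 / 0 exact-float instances (and the closed-form sufficient condition
  `k₁(1−g)(1−2λ) ≤ LB1·g(1−λ)`, `LB1 = (k₁+k₂−t)[k₁(k₂−k₁)² + a(k₂−a)(k₁+k₂−t)]/((k₂−k₁)²(k₂−ℓ))`, 1 500 / 0, min slack 0.05;
  engines `run/shared/lean/prim/quant/prim-quant-arm-2-g36/code/scan19.py`).
HONEST STATUS: `MixLawCellPDear` open modulo (I_{U₁}) on the thin regime; `MixLawRegimeB`, `GatedSliceMixLaw'`, CW,
`SingleGateConvClosed`, `TreeDEC`, `FarTreeRow` OPEN; RATE class log* / honest sentence unchanged.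

[this work]; pooled inequality and cells: census-2 g61; routing shell: arm-1 g41 (this lane).  Nothing here is cited as a published
result.  The gluing rows served [cite: KozmaNitzan2024, Conjecture 3 (p. 15)]; product measure [cite: Grimmett1999, §1.3 p. 10].
-/

noncomputable section

namespace Summit.CriticalPhenomena.PercolationContinuityZ3.Theorems

namespace Quant

open Finset

/-- the two-point law `{lo, hi; g}` (as in `…QuantLawDEC`) -/
local notation3 "TP[" lo ", " hi ", " g ", " h "]" =>
  (g : ℝ) * (if (h : ℕ) = (hi : ℕ) then (1 : ℝ) else 0) + (1 - (g : ℝ)) * (if (h : ℕ) = (lo : ℕ) then (1 : ℝ) else 0)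

namespace LawDec

/-! ### Usage is nondecreasing in the floor -/

/-- **usage of a compatible mid pair is nondecreasing in the floor**: `0 ≤ x ≤ x' < 1`, `h ≤ j`, `2l < T < l + h` ⟹
`usage x T j l h ≤ usage x' T j l h` (`pairGate x = max(ρ, x² + (1−x)ρ)`: for `x ≤ ρ` the gate is `ρ`, beyond it `x² + (1−x)ρ` increases).
[this work] -/
theorem usage_mono_floor (x x' T : ℝ) (j l h : ℕ) (hx0 : 0 ≤ x) (hxx : x ≤ x') (hx1 : x' < 1) (hhj : h ≤ j)
    (hlow : 2 * (l : ℝ) < T) (hcomp : T < (l : ℝ) + h) :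
    usage x T j l h ≤ usage x' T j l h := by
  have hnj : ¬ (j + 1 ≤ h) := by omega
  have hd : (0 : ℝ) < (h : ℝ) - l := by linarith
  set ρ : ℝ := (T - 2 * (l : ℝ)) / ((h : ℝ) - l) with hρ
  have hρ0 : 0 ≤ ρ := div_nonneg (by linarith) hd.le
  have hρ1 : ρ < 1 := by rw [hρ, div_lt_one hd]; linarith
  simp only [usage, gateOf, if_neg hnj, pairGate]
  rw [← hρ]
  -- the gates
  have hgate : max ρ (x ^ 2 + (1 - x) * ρ) ≤ max ρ (x' ^ 2 + (1 - x') * ρ) := by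
    refine max_le (le_max_left _ _) ?_
    by_cases hxρ : x ≤ ρ
    · have : x ^ 2 + (1 - x) * ρ ≤ ρ := by nlinarith
      exact this.trans (le_max_left _ _)
    · have hxρ' : ρ < x := not_le.1 hxρ
      have : x ^ 2 + (1 - x) * ρ ≤ x' ^ 2 + (1 - x') * ρ := by nlinarith
      exact this.trans (le_max_right _ _)
  have hlt1 : max ρ (x' ^ 2 + (1 - x') * ρ) < 1 := by
    refine max_lt hρ1 ?_
    nlinarith
  have hlt0 : max ρ (x ^ 2 + (1 - x) * ρ) < 1 := lt_of_le_of_lt hgate hlt1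
  rw [div_le_div_iff₀ (by linarith) (by linarith)]
  nlinarith

/-! ### (I_{U₁}) when the mid has top room at the raised floor -/

set_option maxHeartbeats 400000 in
/-- **(I_{U₁}) WHEN `ρ₁·k₂ ≤ S`** (`ρ₁ = (t−2k₁)/(k₂−k₁)`; equivalently `U₁ ≤ X_S = S/(k₂−S)`): at the raised floor `ρ₁` the low
`k₁` is exactly dear and `u(ρ₁) = U₁`, so census-2's `pooled_dear` (which needs only `ρ₁·k₂ ≤ S`) gives
`usage(ρ₁; ℓ,k₂)·m₁' + U₁·m₁ + U₁·z ≤ (1−z)λ`; `usage` is nondecreasing in the floor and `U₁ ≥ u`. [this work] -/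
theorem kink_member_U1_of_topRoom (y z g S lam : ℝ) (a j k₁ k₂ : ℕ)
    (hy0 : 0 < y) (hy1 : y < 1) (hz0 : 0 ≤ z) (hz1 : z < 1) (hg0 : 0 ≤ g) (hg1 : g ≤ 1)
    (hlam0 : 0 ≤ lam) (hlam1 : lam < 1) (hk₂j : k₂ ≤ j)
    (hmean : (1 - z) * ((k₁ : ℝ) + ((k₂ : ℝ) - k₁) * lam) = S)
    (hk₁low : 2 * (k₁ : ℝ) < S + (a : ℝ) * g * (1 - z)) (hPlow : 2 * ((k₁ + a : ℕ) : ℝ) < S + (a : ℝ) * g * (1 - z))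
    (hcomp : S + (a : ℝ) * g * (1 - z) < ((k₁ + a : ℕ) : ℝ) + k₂) (hc1 : S + (a : ℝ) * g * (1 - z) < (k₁ : ℝ) + k₂)
    (hdear : y * ((k₂ : ℝ) - k₁) ≤ S + (a : ℝ) * g * (1 - z) - 2 * (k₁ : ℝ))
    (htop : (S + (a : ℝ) * g * (1 - z) - 2 * (k₁ : ℝ)) * (k₂ : ℝ) ≤ S * ((k₂ : ℝ) - k₁)) :
    usage y (S + (a : ℝ) * g * (1 - z)) j k₁ k₂ * (z + (1 - z) * (1 - lam) * (1 - g))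
        + usage y (S + (a : ℝ) * g * (1 - z)) j (k₁ + a) k₂ * ((1 - z) * (1 - lam) * g)
      ≤ (1 - z) * lam * (1 - g) + usage y (S + (a : ℝ) * g * (1 - z)) j k₁ k₂ * ((1 - y) / y) * ((1 - z) * lam * g) := by
  set t : ℝ := S + (a : ℝ) * g * (1 - z) with ht
  have h1y : 0 < 1 - y := by linarith
  have h1z : 0 < 1 - z := by linarith
  have hK : (0 : ℝ) < (k₂ : ℝ) - k₁ := by linarith
  have hden : (0 : ℝ) < (k₂ : ℝ) - t + k₁ := by linarith
  -- the raised floor ρ₁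
  set ρ₁ : ℝ := (t - 2 * (k₁ : ℝ)) / ((k₂ : ℝ) - k₁) with hρ₁
  have hρ₁y : y ≤ ρ₁ := by rw [hρ₁, le_div_iff₀ hK]; exact hdear
  have hρ₁0 : 0 < ρ₁ := lt_of_lt_of_le hy0 hρ₁y
  have hρ₁1 : ρ₁ < 1 := by rw [hρ₁, div_lt_one hK]; linarith
  have hρ₁k₂ : ρ₁ * (k₂ : ℝ) ≤ S := by rw [hρ₁, div_mul_eq_mul_div, div_le_iff₀ hK]; exact htop
  have hρ₁dear : ρ₁ * ((k₂ : ℝ) - k₁) ≤ t - 2 * (k₁ : ℝ) := by rw [hρ₁, div_mul_cancel₀ _ hK.ne']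
  have hSk₂ : S < (k₂ : ℝ) := by
    have hkr : (k₁ : ℝ) < k₂ := by linarith
    have h1 : (k₁ : ℝ) + ((k₂ : ℝ) - k₁) * lam < k₂ := by nlinarith
    have hX0 : 0 ≤ (k₁ : ℝ) + ((k₂ : ℝ) - k₁) * lam := by
      have : (0 : ℝ) ≤ k₁ := Nat.cast_nonneg k₁
      nlinarith
    have h2 : (1 - z) * ((k₁ : ℝ) + ((k₂ : ℝ) - k₁) * lam) ≤ (k₁ : ℝ) + ((k₂ : ℝ) - k₁) * lam :=
      mul_le_of_le_one_left hX0 (by linarith)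
    linarith
  -- pooled_dear at floor ρ₁
  have hpool := pooled_dear ρ₁ z g S lam j k₂ a k₁ hρ₁0 hρ₁1 hz0 hz1.le hg0 hg1 hlam1.le hk₂j hSk₂ hρ₁k₂ hmean hPlow hρ₁dear
  -- u(ρ₁) = U₁ and usage(ρ₁; ℓ, k₂) ≥ usage(y; ℓ, k₂)
  set U1 : ℝ := usage y t j k₁ k₂ with hU1d
  have eU1 : U1 = (t - 2 * (k₁ : ℝ)) / ((k₁ : ℝ) + k₂ - t) := by
    rw [hU1d]; exact usage_eq_heavy' y t j k₁ k₂ hy0 hy1 hk₂j hk₁low hc1 hdear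
  have euρ : ρ₁ / (1 - ρ₁) = U1 := by
    have hpos2 : (0 : ℝ) < (k₁ : ℝ) + k₂ - t := by linarith
    have e1 : 1 - ρ₁ = ((k₁ : ℝ) + k₂ - t) / ((k₂ : ℝ) - k₁) := by
      rw [hρ₁, eq_div_iff hK.ne']
      field_simp
      ring
    rw [eU1, e1, hρ₁, div_div_div_cancel_right₀ hK.ne']
  have hmono : usage y t j (k₁ + a) k₂ ≤ usage ρ₁ t j (k₁ + a) k₂ :=
    usage_mono_floor y ρ₁ t j (k₁ + a) k₂ hy0.le hρ₁y hρ₁1 hk₂j hPlow hcomp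
  have hU1u : y / (1 - y) ≤ U1 := by
    rw [← euρ, div_le_div_iff₀ h1y (by linarith)]
    nlinarith
  -- assemble
  have hB0 : 0 ≤ (1 - z) * (1 - lam) * g := mul_nonneg (mul_nonneg h1z.le (by linarith)) hg0
  have hD0 : 0 ≤ (1 - z) * lam * g := mul_nonneg (mul_nonneg h1z.le hlam0) hg0
  rw [euρ] at hpool
  have e1 : (1 - z) * lam = (1 - z) * lam * (1 - g) + (1 - z) * lam * g := by ring
  have h2 : usage y t j (k₁ + a) k₂ * ((1 - z) * (1 - lam) * g) ≤ usage ρ₁ t j (k₁ + a) k₂ * ((1 - z) * (1 - lam) * g) :=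
    mul_le_mul_of_nonneg_right hmono hB0
  -- (1−z)λg ≤ U1·((1−y)/y)·(1−z)λg since U1 ≥ u
  have h3 : (1 - z) * lam * g ≤ U1 * ((1 - y) / y) * ((1 - z) * lam * g) := by
    have hone : 1 ≤ U1 * ((1 - y) / y) := by
      have := mul_le_mul_of_nonneg_right hU1u (show 0 ≤ (1 - y) / y by positivity)
      have e : y / (1 - y) * ((1 - y) / y) = 1 := by field_simp
      linarith [this, e]
    nlinarith
  nlinarith [hpool, h2, h3, e1]

/-- **(I_{U₁}) from the frame, given its validity on the thin regime only** (`kink_member_U1` with the top-room case removed by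
`kink_member_U1_of_topRoom`). [this work] -/
theorem kink_member_U1' (y z g S lam : ℝ) (a j k₁ k₂ : ℕ)
    (hy0 : 0 < y) (hy1 : y < 1) (hz0 : 0 ≤ z) (hz1 : z < 1) (hg0 : 0 ≤ g) (hg1 : g ≤ 1) (hyg : y ≤ (1 - z) * g)
    (hlam0 : 0 ≤ lam) (hlam1 : lam < 1) (hk₂j : k₂ ≤ j) (hyk₂ : y * (k₂ : ℝ) ≤ S)
    (hmean : (1 - z) * ((k₁ : ℝ) + ((k₂ : ℝ) - k₁) * lam) = S)
    (hk₁low : 2 * (k₁ : ℝ) < S + (a : ℝ) * g * (1 - z)) (hPlow : 2 * ((k₁ + a : ℕ) : ℝ) < S + (a : ℝ) * g * (1 - z))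
    (hk₂mid : S + (a : ℝ) * g * (1 - z) ≤ 2 * (k₂ : ℝ)) (hcomp : S + (a : ℝ) * g * (1 - z) < ((k₁ + a : ℕ) : ℝ) + k₂)
    (hc1 : S + (a : ℝ) * g * (1 - z) < (k₁ : ℝ) + k₂)
    (hdear : y * ((k₂ : ℝ) - k₁) ≤ S + (a : ℝ) * g * (1 - z) - 2 * (k₁ : ℝ))
    (hthin : y / (1 - y) * z < (1 - z) * lam * g →
      (1 - z) * lam * g < y / (1 - y) * (z + (1 - z) * (1 - lam) * (1 - g)) →
      (S + (a : ℝ) * g * (1 - z) - 2 * (k₁ : ℝ)) * ((1 - y) / y) < (k₂ : ℝ) + a - (S + (a : ℝ) * g * (1 - z)) →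
      S * ((k₂ : ℝ) - k₁) < (S + (a : ℝ) * g * (1 - z) - 2 * (k₁ : ℝ)) * (k₂ : ℝ) →
      usage y (S + (a : ℝ) * g * (1 - z)) j k₁ k₂ * (z + (1 - z) * (1 - lam) * (1 - g))
        + usage y (S + (a : ℝ) * g * (1 - z)) j (k₁ + a) k₂ * ((1 - z) * (1 - lam) * g)
      ≤ (1 - z) * lam * (1 - g) + usage y (S + (a : ℝ) * g * (1 - z)) j k₁ k₂ * ((1 - y) / y) * ((1 - z) * lam * g)) :
    usage y (S + (a : ℝ) * g * (1 - z)) j k₁ k₂ * (z + (1 - z) * (1 - lam) * (1 - g))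
        + usage y (S + (a : ℝ) * g * (1 - z)) j (k₁ + a) k₂ * ((1 - z) * (1 - lam) * g)
      ≤ (1 - z) * lam * (1 - g) + usage y (S + (a : ℝ) * g * (1 - z)) j k₁ k₂ * ((1 - y) / y) * ((1 - z) * lam * g) := by
  by_cases htop : (S + (a : ℝ) * g * (1 - z) - 2 * (k₁ : ℝ)) * (k₂ : ℝ) ≤ S * ((k₂ : ℝ) - k₁)
  · exact kink_member_U1_of_topRoom y z g S lam a j k₁ k₂ hy0 hy1 hz0 hz1 hg0 hg1 hlam0 hlam1 hk₂j hmean hk₁low hPlow hcomp hc1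
      hdear htop
  · exact kink_member_U1 y z g S lam a j k₁ k₂ hy0 hy1 hz0 hz1 hg0 hg1 hyg hlam0 hlam1 hk₂j hyk₂ hmean hk₁low hPlow hk₂mid hcomp hc1
      hdear (fun h1 h2 h3 => hthin h1 h2 h3 (not_le.1 htop))

/-! ### `MixLawCellPDear` modulo the thin regime -/

/-- **`MixLawCellPDear` FROM (I_{U₁}) ON THE THIN REGIME.**  The hypothesis is (I_{U₁}) quantified over the cell, with the antecedents of
the thin regime: `k₁` compatible and the mid short of room (`m₂ − U_dm₁' < U₁m₁`), `u z < m₂' < u(z + m₁)`, `(t−2k₁)/u < k₂ + a − t`,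
`S(k₂−k₁) < (t−2k₁)k₂`.  Everything else is `decAtT_movedTwoPoint_PDear_of_kink` + `kink_member_U1'`. [this work] -/
theorem mixLawCellPDear_of_thinKink
    (hthin : ∀ (y z g S lam : ℝ) (a j k₁ k₂ : ℕ),
      0 < y → y < 1 → 0 ≤ z → z < 1 → 0 ≤ g → g ≤ 1 → y ≤ (1 - z) * g → 0 ≤ lam → lam < 1 → k₂ ≤ j → y * (k₂ : ℝ) ≤ S →
      (1 - z) * ((k₁ : ℝ) + ((k₂ : ℝ) - k₁) * lam) = S →
      2 * (k₁ : ℝ) < S + (a : ℝ) * g * (1 - z) → 2 * ((k₁ + a : ℕ) : ℝ) < S + (a : ℝ) * g * (1 - z) →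
      S + (a : ℝ) * g * (1 - z) ≤ 2 * (k₂ : ℝ) → S + (a : ℝ) * g * (1 - z) < ((k₁ + a : ℕ) : ℝ) + k₂ →
      S + (a : ℝ) * g * (1 - z) < (k₁ : ℝ) + k₂ →
      y * ((k₂ : ℝ) - k₁) ≤ S + (a : ℝ) * g * (1 - z) - 2 * (k₁ : ℝ) →
      (1 - z) * lam * (1 - g) - usage y (S + (a : ℝ) * g * (1 - z)) j (k₁ + a) k₂ * ((1 - z) * (1 - lam) * g)
        < usage y (S + (a : ℝ) * g * (1 - z)) j k₁ k₂ * ((1 - z) * (1 - lam) * (1 - g)) →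
      y / (1 - y) * z < (1 - z) * lam * g →
      (1 - z) * lam * g < y / (1 - y) * (z + (1 - z) * (1 - lam) * (1 - g)) →
      (S + (a : ℝ) * g * (1 - z) - 2 * (k₁ : ℝ)) * ((1 - y) / y) < (k₂ : ℝ) + a - (S + (a : ℝ) * g * (1 - z)) →
      S * ((k₂ : ℝ) - k₁) < (S + (a : ℝ) * g * (1 - z) - 2 * (k₁ : ℝ)) * (k₂ : ℝ) →
      usage y (S + (a : ℝ) * g * (1 - z)) j k₁ k₂ * (z + (1 - z) * (1 - lam) * (1 - g))
        + usage y (S + (a : ℝ) * g * (1 - z)) j (k₁ + a) k₂ * ((1 - z) * (1 - lam) * g)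
      ≤ (1 - z) * lam * (1 - g) + usage y (S + (a : ℝ) * g * (1 - z)) j k₁ k₂ * ((1 - y) / y) * ((1 - z) * lam * g)) :
    MixLawCellPDear := by
  intro y z g S lam a j M k₁ k₂ hy0 hy1 hz0 hz1 hg1 hyg ha1 hjM hS0 hta hSj hSM hk hk₂M hlam0 hlam1 hmean hk₁j hk₁low hPj hPlow
    hk₂j hk₂mid hcomp hG hdear hsat
  have hg0 : 0 ≤ g := by nlinarith
  have hyk₂ : y * (k₂ : ℝ) ≤ S := le_trans (mul_le_mul_of_nonneg_left (by exact_mod_cast hk₂M) hy0.le) hta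
  refine decAtT_movedTwoPoint_PDear_of_kink y z g S lam a j M k₁ k₂ hy0 hy1 hz0 hz1 hg1 hyg ha1 hjM hS0 hta hSj hSM hk hk₂M hlam0
    hlam1 hmean hk₁j hk₁low hPj hPlow hk₂j hk₂mid hcomp hG hdear hsat (fun hc1 hL => ?_)
  -- λ < 1 from the shortage: U₁·m₁ > m₂ − U_d m₁' ≥ 0 forces m₁ ≠ 0
  have hA0 : 0 ≤ (1 - z) * (1 - lam) * (1 - g) := mul_nonneg (mul_nonneg (by linarith) (by linarith)) (by linarith)
  have hlam1' : lam < 1 := by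
    by_contra hge
    have hl1 : lam = 1 := le_antisymm hlam1 (not_lt.1 hge)
    have hA : (1 - z) * (1 - lam) * (1 - g) = 0 := by rw [hl1]; ring
    rw [hA, mul_zero] at hL
    have hB : (1 - z) * (1 - lam) * g = 0 := by rw [hl1]; ring
    rw [hB, mul_zero, sub_zero] at hL
    have : 0 ≤ (1 - z) * lam * (1 - g) := mul_nonneg (mul_nonneg (by linarith) hlam0) (by linarith)
    linarith
  exact kink_member_U1' y z g S lam a j k₁ k₂ hy0 hy1 hz0 hz1 hg0 hg1 hyg hlam0 hlam1' hk₂j hyk₂ hmean hk₁low hPlow hk₂mid hcomp hc1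
    hdear (hthin y z g S lam a j k₁ k₂ hy0 hy1 hz0 hz1 hg0 hg1 hyg hlam0 hlam1' hk₂j hyk₂ hmean hk₁low hPlow hk₂mid hcomp hc1 hdear hL)

end LawDec

end Quant

end Summit.CriticalPhenomena.PercolationContinuityZ3.Theorems
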